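import Summits.BirchSwinnertonDyer.BirchSwinnertonDyer.Theorems.EdixhovenFibreFiveSevenStarredOptimalManinUnitFiveSevenAssemblyAtBar
import Summits.BirchSwinnertonDyer.BirchSwinnertonDyer.Theorems.EdixhovenFibreFiveSevenStarredOptimalManinUnitFiveSevenSupersingularCellsDeRhamHolds
import HarnessLib

/-!
# Crux K★ `StarredOptimalManinUnitFiveSeven` (stmt-BirchSwinnertonDyer-22226), line `kato-lever`: the cone of the registered
# skeleton FED BY THE PRINT-FAITHFUL P1 `exists_member_sl2ZetaElement_neron_values_bar` — K★ BY NAME ⟸ {P1-bar, hT₂}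

Cell `pub/bsd-wall`, seat `bsd-line-edix-p4` g14 (erratum DD-UE-1 of the audit sheet
`pub/bsd-cited/sheets/D-AUDIT-r02-UE-Kato2004-SL2NeronValues-813-97-66-136.md`: the value-law factor of the cite-only fact P1
`exists_member_sl2ZetaElement_neron_values` reads `χ(c)` where Kato prints `χ̄(c)`; the print-faithful statement is
`exists_member_sl2ZetaElement_neron_values_bar`, appended to `Kato2004/EulerSystemSL2NeronValues.lean`). TOOL theorems only (no
definition, no named fact, no `sorry`, no local instance); `--supports` 22226 (helper); nothing is closed; BSD is not proved by
any of this.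

WHAT. Verbatim twins, fed by the opener twin `KatoAssemblySocketAt.katoNeronBody_of_sl2NeronValuesBar_of_isDeRhamAt`, of
`StarredOptimalManinUnitFiveSevenCellsOfSL2NeronValues.starredOptimalManinUnit_ordinaryCells_of_sl2NeronValues` /
`…_of_sl2NeronValues_of_isDeRham_supersingularCells` (seat edix-p4 g9) and of
`StarredOptimalManinUnitFiveSevenSupersingularCellsExplicit.starredOptimalManinUnitFiveSeven_of_sl2NeronValues_of_explicitCapstone`
(p678244), and the two-hypothesis closer:

* `starredOptimalManinUnit_ordinaryCells_of_sl2NeronValuesBar` — `p ∤ c(D)` on the three (G)-ordinary starred cells ⟸ {P1-bar, hT₂}.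
* `starredOptimalManinUnitFiveSeven_of_sl2NeronValuesBar_of_isDeRham_supersingularCells` — K★ BY NAME ⟸ {P1-bar, hT₂, hDRss}.
* `starredOptimalManinUnitFiveSeven_of_sl2NeronValuesBar_of_explicitCapstone` — K★ BY NAME ⟸ {P1-bar, hT₂, hR'}.
* ★ `starredOptimalManinUnitFiveSeven_of_expStarTower_of_sl2NeronValuesBar` — **K★ BY NAME ⟸ {P1-bar, hT₂}** (`hR'` is the tree
  theorem `isDeRham_restrictedRationalTateRep_of_explicitModel`, p684991). The registered skeleton `Lines/kato_lever.lean` becomes,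
  with `stub_sl2NeronValues : Kato2004.exists_member_sl2ZetaElement_neron_values_bar`, the one-liner
  `starredOptimalManinUnitFiveSeven_of_expStarTower_of_sl2NeronValuesBar stub_expStarTower stub_sl2NeronValues`.
CONDITIONAL on P1-bar / hT₂ (cite-only, XL); K★ stays OPEN.

References: [Kato2004Asterisque] (8.1.3) p. 180, Thm. 9.7 p. 189, Thm. 6.6 (1) p. 163, Thm. 5.6 p. 157, Thm. 13.6 p. 227;
[Kato1993LNM1553] Ch. II Prop. 1.2.3, Ex. 1.3.5, Thm. 1.4.1; [BlochKato1990] Prop. 3.8, Ex. 3.11; [KimNakamura2020] Cor. 2.4;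
[KostersPannekoek2017] Thm. 1; [EdixhovenManin1991] Thm. 3; [DokchitserDokchitser2015LocalInvariants] Thm. 3.2;
[Fontaine1982FormesDifferentielles] §5; [Colmez1992PeriodesAbeliennes] §2.
-/

set_option autoImplicit false
-- the Theorems namespace of a single-conjunct summit repeats the summit name by design (D-0017)
set_option linter.dupNamespace false

noncomputable section

open scoped Classical MatrixGroups NumberField

open WeierstrassCurve NumberField IsDedekindDomain Field ValuativeRel Polynomial
  Literature.NumberTheory.EllipticCurves Literature.NumberTheory.EllipticCurves.ModularForms
  Literature.NumberTheory.EllipticCurves.Rank1Residual Literature.NumberTheory.EllipticCurves.Kato2004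
  Literature.NumberTheory.DiophantineGeometry Rat.HeightOneSpectrum
  Literature.NumberTheory.PAdicHodge Literature.NumberTheory.GaloisRepresentations
  Literature.NumberTheory.GaloisRepresentations.IsNonarchimedeanLocalField
  Summit.BirchSwinnertonDyer.Rank1Residual Summit.BirchSwinnertonDyer.Rank1Residual.Additive
  Summit.BirchSwinnertonDyer.BirchSwinnertonDyer.Theorems
  Summit.BirchSwinnertonDyer.BirchSwinnertonDyer.Theorems.KatoAssemblySocketAt
  Summit.BirchSwinnertonDyer.BirchSwinnertonDyer.Theorems.ManinFrameResidueProperRTameTwistAt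
  Summit.BirchSwinnertonDyer.BirchSwinnertonDyer.Theorems.StarredOptimalManinUnitFiveSevenSupersingularCellsExplicit
  CongruenceSubgroup Complex

namespace Summit.BirchSwinnertonDyer.BirchSwinnertonDyer.Theorems.StarredOptimalManinUnitFiveSevenCellsOfSL2NeronValuesBar

/-- **K★ on the three (G)-ORDINARY starred cells `(5; III*), (7; IV*), (7; II*)` GRANTED ONLY the print-faithful P1-bar and (S5b-tower).** For `W/ℚ`
globally minimal, `p ∈ {5, 7}`, additive at `p`, `E[p]` irreducible, no `Iₙ*` fibre at `p`, `4 < ord_p Δ_min`, ON THE HALF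
`p = 5 ↔ ord_p Δ_min = 9`, and `D` a lattice-optimal conductor-level datum: `p ∤ c(D)`. The de Rham input of Kato's argument
is the tree theorem `isDeRham_restrictedRationalTateRep_adicCompletion_rat_of_starred_fiveSeven_ordinary` for THIS `W`; Kato II
Prop. 1.2.3 is the tree theorem `cupLogInjective_and_hasDualExp_of_isDeRham_holds`. CONDITIONAL on the cite-only P1-bar / hT₂.
[cite: Kato2004Asterisque, (8.1.3) (p. 180), Thm. 9.7 (p. 189)] [cite: KimNakamura2020, Cor. 2.4] [cite: KostersPannekoek2017, Thm. 1]
[cite: DokchitserDokchitser2015LocalInvariants, Thm. 3.2] [cite: Kato1993LNM1553, Ch. II Ex. 1.3.5] -/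
theorem starredOptimalManinUnit_ordinaryCells_of_sl2NeronValuesBar
    (hT₂ : exists_smul_range_expStarCoord_tower_iff_trace_log) (hP1 : exists_member_sl2ZetaElement_neron_values_bar)
    (W : WeierstrassCurve ℚ) [W.IsElliptic] [W.IsGloballyMinimal] (p : ℕ) [Fact p.Prime] {N : ℕ} [NeZero N]
    (D : ModularParametrizationData W N) (hN : N = W.conductorNorm ℤ) (hp57 : p = 5 ∨ p = 7) (hadd : Addv W p) (hirr : Irr W p)
    (hIstar : ∀ (v : HeightOneSpectrum ℤ) (n : ℕ), natGenerator v = p → W.kodairaSymbolAt v ≠ KodairaSymbol.Istar n)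
    (h4 : 4 < padicValInt p W.minimalDiscriminantInt) (hord : p = 5 ↔ padicValInt p W.minimalDiscriminantInt = 9)
    (hopt : ∀ z ∈ D.L.lattice, ∃ w ∈ periodLattice D.f, z = D.c * w) :
    ¬ (p : ℤ) ∣ D.c := by
  subst hN
  have hp5 : 5 ≤ p := by rcases hp57 with rfl | rfl <;> norm_num
  have hPT : ∀ P : (W.baseChange ℚ_[p]).toAffine.Point, p • P = 0 → P = 0 :=
    fun P hP ↦ eq_zero_of_prime_nsmul_eq_zero_of_addv_of_four_le W p hp5 hadd (le_of_lt h4) hP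
  have hpN : p ^ 2 ∣ W.conductorNorm ℤ := sq_dvd_conductorNorm_of_not_good_of_not_mult hadd
  have ha : ∀ ℓ ∈ (W.conductorNorm ℤ).primeFactors, ¬ ℓ ^ 2 ∣ W.conductorNorm ℤ →
      W.LFunction ℓ = 1 ∨ W.LFunction ℓ = -1 := by
    intro ℓ hℓ hℓ2
    haveI : Fact ℓ.Prime := ⟨Nat.prime_of_mem_primeFactors hℓ⟩
    rcases hasGoodReductionAtPrime_or_hasMultiplicativeReductionAtPrime_of_not_sq_dvd_conductorNorm (V := W) hℓ2
      with hg | hmul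
    · exact absurd (Nat.dvd_of_mem_primeFactors hℓ) (not_dvd_conductorNorm_of_hasGoodReductionAtPrime W hg)
    · exact KrausOesterle1992.lFunction_apply_prime_eq_one_or_eq_neg_one_of_mult W ℓ hmul
  refine not_dvd_c_of_tameTwist57_at hp57 W ?_ D hopt hPT hadd hirr hpN ha
  intro M _ g hg hp5' hng hnm hirr' m _ hcop hcl χ hχ hχ1 hord' ϖ r
  refine katoNeronBody_of_sl2NeronValuesBar_of_isDeRhamAt hT₂ cupLogInjective_and_hasDualExp_of_isDeRham_holds hP1 W p
    ?_ g hg hp5' hng hnm hirr' m hcop hcl χ hχ hχ1 hord' ϖ r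
  intro v hpv _ _ _ hp' _
  exact isDeRham_restrictedRationalTateRep_adicCompletion_rat_of_starred_fiveSeven_ordinary W p hp57 hadd hIstar h4 hord
    v hpv hp'

/-- **K★ `StarredOptimalManinUnitFiveSeven` BY NAME, GRANTED P1-bar, (S5b-tower) and de Rham-ness of `V_pW|_{Γ_{ℚ_v}}` ON THE THREE
POTENTIALLY SUPERSINGULAR STARRED CELLS ONLY** (`(5; IV*), (5; II*), (7; III*)`, i.e. `¬ (p = 5 ↔ ord_p Δ_min = 9)`; displayed
hypothesis `hDRss`, in the binder shape of the tree's per-curve de Rham theorems — the exact residual of hDR on this line). On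
the (G)-ordinary cells the de Rham input is a tree theorem (`starredOptimalManinUnit_ordinaryCells_of_sl2NeronValuesBar`).
CONDITIONAL; the item is not closed by this. [cite: Kato2004Asterisque, (8.1.3) (p. 180), Thm. 9.7 (p. 189)]
[cite: Kato1993LNM1553, Ch. II Ex. 1.3.5] [cite: KostersPannekoek2017, Thm. 1] [cite: EdixhovenManin1991, Thm. 3] -/
theorem starredOptimalManinUnitFiveSeven_of_sl2NeronValuesBar_of_isDeRham_supersingularCells
    (hT₂ : exists_smul_range_expStarCoord_tower_iff_trace_log) (hP1 : exists_member_sl2ZetaElement_neron_values_bar)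
    (hDRss : ∀ (W : WeierstrassCurve ℚ) [W.IsElliptic] [W.IsGloballyMinimal] (p : ℕ) [Fact p.Prime],
      (p = 5 ∨ p = 7) → Addv W p → Irr W p →
      (∀ (v : HeightOneSpectrum ℤ) (n : ℕ), natGenerator v = p → W.kodairaSymbolAt v ≠ KodairaSymbol.Istar n) →
      4 < padicValInt p W.minimalDiscriminantInt → ¬ (p = 5 ↔ padicValInt p W.minimalDiscriminantInt = 9) →
      ∀ (v : HeightOneSpectrum (𝓞 ℚ)), ((p : ℕ) : 𝓞 ℚ) ∈ v.asIdeal →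
      ∀ [CharZero (v.adicCompletion ℚ)] [Fact (¬ IsUnit (p : integerC (v.adicCompletion ℚ)))]
        [IsAdicComplete (Ideal.span {(p : integerC (v.adicCompletion ℚ))}) (integerC (v.adicCompletion ℚ))]
        (hp' : valuation (v.adicCompletion ℚ) p < 1) [Algebra ℚ_[p] (v.adicCompletion ℚ)],
        GaloisRep.IsDeRham (bdRPeriodRingData (F := v.adicCompletion ℚ) (p := p) hp')
          (restrictedRationalTateRep W (v.adicCompletion ℚ) p)) :
    Summit.BirchSwinnertonDyer.BirchSwinnertonDyer.Theses.EdixhovenFibreFiveSeven.StarredOptimalManinUnitFiveSeven := by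
  intro W _ _ p _ _ D hp57 hadd hirr hIstar h4 hopt
  by_cases hord : (p = 5 ↔ padicValInt p W.minimalDiscriminantInt = 9)
  · exact starredOptimalManinUnit_ordinaryCells_of_sl2NeronValuesBar hT₂ hP1 W p D rfl hp57 hadd hirr hIstar h4 hord hopt
  · have hp5 : 5 ≤ p := by rcases hp57 with rfl | rfl <;> norm_num
    have hPT : ∀ P : (W.baseChange ℚ_[p]).toAffine.Point, p • P = 0 → P = 0 :=
      fun P hP ↦ eq_zero_of_prime_nsmul_eq_zero_of_addv_of_four_le W p hp5 hadd (le_of_lt h4) hP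
    have hpN : p ^ 2 ∣ W.conductorNorm ℤ := sq_dvd_conductorNorm_of_not_good_of_not_mult hadd
    have ha : ∀ ℓ ∈ (W.conductorNorm ℤ).primeFactors, ¬ ℓ ^ 2 ∣ W.conductorNorm ℤ →
        W.LFunction ℓ = 1 ∨ W.LFunction ℓ = -1 := by
      intro ℓ hℓ hℓ2
      haveI : Fact ℓ.Prime := ⟨Nat.prime_of_mem_primeFactors hℓ⟩
      rcases hasGoodReductionAtPrime_or_hasMultiplicativeReductionAtPrime_of_not_sq_dvd_conductorNorm (V := W) hℓ2
        with hg | hmul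
      · exact absurd (Nat.dvd_of_mem_primeFactors hℓ) (not_dvd_conductorNorm_of_hasGoodReductionAtPrime W hg)
      · exact KrausOesterle1992.lFunction_apply_prime_eq_one_or_eq_neg_one_of_mult W ℓ hmul
    refine not_dvd_c_of_tameTwist57_at hp57 W ?_ D hopt hPT hadd hirr hpN ha
    intro M _ g hg hp5' hng hnm hirr' m _ hcop hcl χ hχ hχ1 hord' ϖ r
    refine katoNeronBody_of_sl2NeronValuesBar_of_isDeRhamAt hT₂ cupLogInjective_and_hasDualExp_of_isDeRham_holds hP1 W p
      ?_ g hg hp5' hng hnm hirr' m hcop hcl χ hχ hχ1 hord' ϖ r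
    intro v hpv _ _ _ hp' _
    exact hDRss W p hp57 hadd hirr hIstar h4 hord v hpv hp'

/-- **K★ `StarredOptimalManinUnitFiveSeven` BY NAME, GRANTED {P1-bar, hT₂, the explicit-model capstone `hR'`}** — the de Rham input on the
(G)-ordinary cells is a tree theorem, on the supersingular cells it is `isDeRham_supersingularCells_of_explicitCapstone`.
CONDITIONAL; the item is not closed by this. [cite: Kato2004Asterisque, (8.1.3) (p. 180), Thm. 9.7 (p. 189)]
[cite: Fontaine1982FormesDifferentielles, §5] [cite: EdixhovenManin1991, Thm. 3] -/
theorem starredOptimalManinUnitFiveSeven_of_sl2NeronValuesBar_of_explicitCapstone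
    (hT₂ : exists_smul_range_expStarCoord_tower_iff_trace_log) (hP1 : exists_member_sl2ZetaElement_neron_values_bar) :
    (∀ {F : Type} [Field F] [ValuativeRel F] [TopologicalSpace F] [IsNonarchimedeanLocalField F] [CharZero F]
      {p : ℕ} [Fact p.Prime] [Fact (¬ IsUnit (p : integerC F))] [IsAdicComplete (Ideal.span {(p : integerC F)}) (integerC F)]
      (hp : valuation F p < 1) [Algebra ℚ_[p] F] (D : EisensteinRoot F p hp) {e : ℕ}, D.poly = X ^ e - C (p : ℤ_[p]) →
      ∀ {K₀ : Type} [Field K₀] [CharZero K₀] [Algebra K₀ F] (W₀ : WeierstrassCurve K₀) [W₀.IsElliptic]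
      (a b : ℤ_[p]) (r₄ r₆ t₄ t₆ : ℕ),
      (p = 5 ∧ (e = 3 ∧ r₄ = 1 ∧ r₆ = 0 ∧ t₄ = 1 ∧ t₆ = 0 ∨ e = 6 ∧ r₄ = 4 ∧ r₆ = 0 ∧ t₄ = 2 ∧ t₆ = 0) ∨
        p = 7 ∧ e = 4 ∧ r₄ = 0 ∧ r₆ = 2 ∧ t₄ = 0 ∧ t₆ = 1) →
      3 * r₄ = e * t₄ → 2 * r₆ = e * t₆ → IsUnit (64 * a ^ 3 * (p : ℤ_[p]) ^ t₄ + 432 * b ^ 2 * (p : ℤ_[p]) ^ t₆) →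
      W₀.baseChange F = (⟨0, 0, 0, AdjoinRoot.of D.poly a * AdjoinRoot.root D.poly ^ r₄,
        AdjoinRoot.of D.poly b * AdjoinRoot.root D.poly ^ r₆⟩ : WeierstrassCurve D.Coeff).map (EisensteinRoot.Coeff.toF D) →
      GaloisRep.IsDeRham (bdRPeriodRingData (F := F) (p := p) hp) (restrictedRationalTateRep W₀ F p)) →
    Summit.BirchSwinnertonDyer.BirchSwinnertonDyer.Theses.EdixhovenFibreFiveSeven.StarredOptimalManinUnitFiveSeven := fun hR ↦
  starredOptimalManinUnitFiveSeven_of_sl2NeronValuesBar_of_isDeRham_supersingularCells hT₂ hP1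
    (fun W _ _ p _ hp57 hadd hirr hIstar h4 hcell v hpv _ _ _ hp' _ ↦
      isDeRham_supersingularCells_of_explicitCapstone hR W p hp57 hadd hirr hIstar h4 hcell v hpv hp')

/-- ★ **K★ `StarredOptimalManinUnitFiveSeven` BY NAME ⟸ {P1-bar, hT₂} — the two cite-only published facts and nothing else**:
the explicit-model capstone `hR'` is the tree theorem `isDeRham_restrictedRationalTateRep_of_explicitModel`
(`StarredOptimalManinUnitFiveSevenSupersingularCellsDeRhamHolds.explicitCapstone_holds`), the (G)-ordinary cells' de Rham input is
`isDeRham_restrictedRationalTateRep_adicCompletion_rat_of_starred_fiveSeven_ordinary`, Kato II Prop. 1.2.3 is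
`cupLogInjective_and_hasDualExp_of_isDeRham_holds`. This is the composition of the registered skeleton `Lines/kato_lever.lean` v4
with P1 replaced by the print-faithful `exists_member_sl2ZetaElement_neron_values_bar`. CONDITIONAL on P1-bar and hT₂ (cite-only, XL);
the item is not closed by this. [cite: Kato2004Asterisque, (8.1.3) (p. 180), Thm. 9.7 (p. 189), Thm. 6.6 (1) (p. 163)]
[cite: Kato1993LNM1553, Ch. II Thm. 1.4.1 (3)–(4)] [cite: Fontaine1982FormesDifferentielles, §5] [cite: EdixhovenManin1991, Thm. 3] -/
theorem starredOptimalManinUnitFiveSeven_of_expStarTower_of_sl2NeronValuesBar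
    (hT₂ : exists_smul_range_expStarCoord_tower_iff_trace_log) (hP1 : exists_member_sl2ZetaElement_neron_values_bar) :
    Summit.BirchSwinnertonDyer.BirchSwinnertonDyer.Theses.EdixhovenFibreFiveSeven.StarredOptimalManinUnitFiveSeven :=
  starredOptimalManinUnitFiveSeven_of_sl2NeronValuesBar_of_explicitCapstone hT₂ hP1
    StarredOptimalManinUnitFiveSevenSupersingularCellsDeRhamHolds.explicitCapstone_holds

end Summit.BirchSwinnertonDyer.BirchSwinnertonDyer.Theorems.StarredOptimalManinUnitFiveSevenCellsOfSL2NeronValuesBar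

end
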